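import Summits.HodgeConjecture.HodgeConjecture.Theorems.EightfoldBlochSeedsBlochSeedsGenericPad4WeilClassSupported
import Summits.HodgeConjecture.HodgeConjecture.Theorems.EightfoldBlochSeedsBlochSeedsGenericPad4SeedMinimalClauses
import Literature.AlgebraicGeometry.HodgeTheory.KleimanSmoothingCycles
import HarnessLib

/-!
# Route `EightfoldBlochSeeds`, cruxes `BlochSeedsGeneric` (stmt-HodgeConjecture-18880) / `BlochSeedDiscThree` (18882), line
# `pad4-cm-anchor`, stub `stub_pad4_carrier`: THE CARRIER SUB-RUNG FOR EVERY `d` MODULO ONE REFEREED NAMED FACT —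
# Kleiman's smoothing of cycles (`(p-1)!·α + n·h^p` is the class of a smooth connected subvariety when `dim α < (dim X + 2)/2`)

HONEST FRAMING. CONDITIONAL support file (`--supports stmt-HodgeConjecture-18880`; serves 18882 verbatim): the body of the registered
stub `stub_pad4_carrier d hd E₀ ψ₀ hE hψ` (`Cruxes/BlochSeedsGeneric/Lines/pad4_cm_anchor.lean` fb115e60acaf2337; `d = 3` copy
d208bf462bd6e07f) is DERIVED, for EVERY discriminant `d ≥ 1` and EVERY CM datum `(E₀, ψ₀)`, from ONE named Literature fact taken as a
HYPOTHESIS — `Literature.AlgebraicGeometry.HodgeTheory.kleiman1969_smoothingCycles_eightfold_codimFour`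
(`Literature/AlgebraicGeometry/HodgeTheory/KleimanSmoothingCycles`, filed by this hand; Kleiman 1969 / Hartshorne's survey Thm. 7.3 / Fulton Ex. 15.3.2,
with Fulton–Lazarsfeld connectedness and the cycle class; UNPROVED in the tree: no Chern classes of vector bundles, no Grassmannian
transversality). Nothing here is unconditional about the stub; nothing here proves the RUNG `stub_rung_pad4_seedAt` (Bloch
semiregularity of the carrier is NOT supplied by smoothing theorems), the cruxes, H2, HC_AV or HC. No definition, no sorry; the named
fact is imported from Literature (statement only, as printed in the special case `dim X = 8`, `codim = 4` that the stub needs).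

WHY NO DESIGN IS NEEDED FOR THE CARRIER (leafhand `leafhand-hodge-eightfoldblochseed-3-g1`; this corrects the census line «(D) a
d-dependent divisor/bundle DESIGN, M per d» of the three earlier hands for the CARRIER half — the design problem remains only for
the semiregular RUNG):
* the Weil classes of the pad-4 anchor are RATIONAL HODGE classes, hence ALGEBRAIC at the anchor (Tate–Murasaki, the tree's
  `pad4Anchor_hodgeClass_mem_algebraicClasses`; packaged with hyperbolicity in `pad4Anchor_hyperbolic_weilClass`);
* the `K`-symmetrised class `h_K = d·e^*a + ψ^*e^*a` is a non-zero rational multiple `μ⁻¹·e'^*a'` of the hyperplane class of ANOTHER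
  projective embedding `e'` (the tree's `exists_projectiveEmbedding_symmetrised`: graph of `ψ`, Segre–diagonal power, Segre embedding);
* KLEIMAN (named fact): for a rational algebraic class `y` of codimension `4` on a smooth projective eightfold with hyperplane datum
  `(e', a')`, some `M·y + c·(e'^*a')⁴`, `M ≥ 1`, is supported on a SMOOTH CONNECTED closed subscheme which is a regular immersion of
  codimension `4` (`3!·α = c₄(E) − n·h⁴` with `E(-1)` globally generated, Fulton Ex. 15.3.2; `c₄(E)` is the class of the degeneracy
  locus of `rk E − 3` general sections, Fulton Ex. 14.3.2 (b)(d), non-singular since the deeper stratum has codimension `10 > 8`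
  (Kleiman, transversality to Schubert cycles; Hartshorne Thm. 7.3: `dim α = 4 < (8 + 2)/2`), connected since `E` is ample and
  `8 > 4·1` (Fulton–Lazarsfeld 1981); a smooth closed subvariety is a local complete intersection; its class is supported on it);
* smooth ∧ connected ⟹ integral (`isIntegral_of_smooth_of_connectedSpace`), the codimension law (`coheight_ge_of_isRegularImmersionOfCodim`),
  and `(μ·h_K)⁴ = μ⁴·h_K⁴` (`cupPowTwo_smul`) give `q·h_K⁴ + w'` supported on an integral lci fourfold with `w' = M·w ≠ 0` rational in
  the Weil plane and `q = c·μ⁴` — the stub's body, with the ORIGINAL `(e, a)` (so the anchor's hyperbolicity clause survives: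
  `exists_rungMinusSemiregularity_pad4_of_kleimanSmoothing`).

WHAT REMAINS (census): for the CARRIER stub only the named fact (L–XL to formalise: Chern classes in `complexBetti`, degeneracy loci,
Kleiman–Bertini, Fulton–Lazarsfeld); for the RUNG additionally Bloch semiregularity of some such carrier — open for every `d`, and by
the uniform-divisor-ring no-go (`Theorems/EightfoldBlochSeedsBlochSeedsGenericUniformDivisorRingNoGo`) any explicit carrier is CM-rigid.

References: [cite: Fulton1998, Example 15.3.2, Example 14.3.2 (b)(d), Example 14.4.13 and §19.1] [cite: FultonLazarsfeld1981, Thm. 1 and §1]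
[cite: Kleiman1969Grassmannians, §4–§5] [cite: Kleiman1974Transversality, Cor. 4] [cite: Bloch1972Semiregularity, Remark (7.5)]
-/

noncomputable section

-- single-problem summit (Problem = Summit): the mandated namespace repeats `HodgeConjecture`.
set_option linter.dupNamespace false

open CategoryTheory AlgebraicGeometry
open Literature.AlgebraicGeometry Literature.AlgebraicGeometry.Motives Literature.AlgebraicGeometry.HodgeTheory
open Literature.AlgebraicTopology.SingularHomology

namespace Summit.HodgeConjecture.HodgeConjecture.Theorems

section General

variable {P : AbelianVariety ℂ} {ψ : P ⟶ P} {d : ℕ}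

/-- **An lci carrier of `q·h_K⁴ + w'` from ANY algebraic non-zero rational Weil class `w`, for ANY `(e, a)`, modulo Kleiman's
smoothing** (general abelian eightfold `(P, ψ)`, `ψ ≫ ψ = -d`, `d ≥ 1`). The `K`-symmetrised class `h_K = d·e^*a + ψ^*e^*a` is
`μ⁻¹·e'^*a'` for another embedding (`exists_projectiveEmbedding_symmetrised`); Kleiman's fact at `(e', a')` gives a smooth connected
regular immersion `i : Z ↪ P` of codimension `4` supporting `M·w + c·(e'^*a')⁴ = (c μ⁴)·h_K⁴ + M·w` (`cupPowTwo_smul`); `Z` is integral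
(`isIntegral_of_smooth_of_connectedSpace`), its points have codimension `≥ 4` (`coheight_ge_of_isRegularImmersionOfCodim`), and
`w' := M·w` is a non-zero rational class of the Weil plane. The conclusion is the body of the skeleton's `HasLciCarrierAt 4 P h_K w'`
spelled out. [cite: Kleiman1969Grassmannians, §5] [cite: Fulton1998, Example 15.3.2] [cite: Bloch1972Semiregularity, Remark (7.5)] -/
theorem exists_lciCarrier_ksymm_of_kleimanSmoothing
    (hKL : Literature.AlgebraicGeometry.HodgeTheory.kleiman1969_smoothingCycles_eightfold_codimFour) (hd : 0 < d)
    (hP : P.dim = 2 * 4) (hψ : ψ ≫ ψ = -(d • 𝟙 P)) (e : ProjectiveEmbedding P.X) {a : complexBetti (projectiveSpace e.n ℂ) 2}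
    (ha : IsRationalClass a) (ha0 : a ≠ 0) {w : complexBetti P.X (2 * 4)} (hwW : w ∈ weilClassesOf P ψ 4 d)
    (hwr : IsRationalClass w) (hw0 : w ≠ 0) (hwalg : w ∈ algebraicClasses P.X 4) :
    ∃ w' : complexBetti P.X (2 * 4), w' ∈ weilClassesOf P ψ 4 d ∧ IsRationalClass w' ∧ w' ≠ 0 ∧
      ∃ (Z : Scheme.{0}) (i : Z ⟶ P.X.left) (q : ℚ),
        IsClosedImmersion i ∧ IsRegularImmersionOfCodim i 4 ∧ AlgebraicGeometry.IsIntegral Z ∧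
        (∀ z ∈ Set.range i.base, (4 : ℕ∞) ≤ Order.coheight z) ∧
        ((q : ℚ) : ℂ) •
            cupPowTwo ((d : ℂ) • complexBetti.map e.ι 2 a + complexBetti.map ψ.hom.hom.hom 2 (complexBetti.map e.ι 2 a)) 4 + w' ∈
          classesSupportedOn P.X (Set.range i.base) (2 * 4) := by
  obtain ⟨e', a', μ, ha', ha'0, hμ, he'⟩ := exists_projectiveEmbedding_symmetrised hd hψ e ha ha0
  have hX : IsSmoothProjective 8 P.X := by
    have h : IsSmoothProjective P.dim P.X := AbelianVariety.isSmoothProjective_holds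
    rwa [hP] at h
  obtain ⟨M, c, Z, i, hM, hreg, hsm, hconn, hsupp⟩ := hKL P.X hX e' a' ha' ha'0 w hwr hwalg
  haveI := hsm
  haveI := hconn
  have hM' : ((M : ℚ) : ℂ) ≠ 0 := by exact_mod_cast hM.ne'
  refine ⟨((M : ℚ) : ℂ) • w, Submodule.smul_mem _ _ hwW, hwr.smul (M : ℚ), smul_ne_zero hM' hw0, Z, i, c * μ ^ 4,
    hreg.isClosedImmersion, hreg, isIntegral_of_smooth_of_connectedSpace (i ≫ P.X.hom),
    coheight_ge_of_isRegularImmersionOfCodim hreg, ?_⟩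
  have key : ((M : ℕ) : ℂ) • w + ((c : ℚ) : ℂ) • cupPowTwo (complexBetti.map e'.ι 2 a') 4 =
      (((c * μ ^ 4 : ℚ)) : ℂ) •
          cupPowTwo ((d : ℂ) • complexBetti.map e.ι 2 a + complexBetti.map ψ.hom.hom.hom 2 (complexBetti.map e.ι 2 a)) 4 +
        ((M : ℚ) : ℂ) • w := by
    rw [he', Literature.AlgebraicGeometry.Hyperkaehler.cupPowTwo_smul, smul_smul, add_comm]
    push_cast
    rfl
  rw [← key]
  exact hsupp

end General

/-! ## At the PAD-4 CM anchor: the carrier stub's body, every `d`, modulo Kleiman's smoothing -/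

section Pad4

variable {d : ℕ} {E₀ : AbelianVariety ℂ} {ψ₀ : E₀ ⟶ E₀}

/-- **`stub_pad4_carrier` FOR EVERY `d ≥ 1` AND EVERY CM DATUM, MODULO KLEIMAN'S SMOOTHING OF CYCLES.** On the pad-4 anchor
`S⁴ = ((S × S) × S) × S`, `S = E₀ × E₀` (`dim E₀ = 1`, `ψ₀ ≫ ψ₀ = -d`), with the nested action `Ψ = (ψ₀ × (−ψ₀))⁴` (the skeletons'
`pad4Action E₀ ψ₀`; instantiate `hΨ` by `rfl`): there are a projective embedding `e`, a rational `a ≠ 0`, a non-zero rational class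
`w` of the Weil plane `weilClassesOf S⁴ Ψ 4 d`, and an INTEGRAL closed subscheme `i : Z ↪ S⁴` which is a REGULAR IMMERSION OF
CODIMENSION `4`, all of whose points have codimension `≥ 4`, supporting `q·h_K⁴ + w` for `h_K = d·e^*a + Ψ^*e^*a` — with
`P := pad4Anchor E₀`, `ψ := pad4Action E₀ ψ₀` this is LITERALLY the body of `stub_pad4_carrier d hd E₀ ψ₀ hE hψ` (the skeleton's
`symH`, `HasLciCarrierAt` unfold by `rfl`). Inputs: the anchor's `(e, a)` and non-zero rational Hodge Weil class
(`pad4Anchor_hyperbolic_weilClass`), Tate–Murasaki at the anchor (`pad4Anchor_hodgeClass_mem_algebraicClasses`), and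
`exists_lciCarrier_ksymm_of_kleimanSmoothing`. CONDITIONAL on the named fact; unconditional in everything else.
[cite: Kleiman1969Grassmannians, §5] [cite: Fulton1998, Example 15.3.2 and §19.1] [cite: vanGeemen1994HodgeAV, Thm. 4.3]
[cite: Bloch1972Semiregularity, Remark (7.5)] -/
theorem exists_pad4_carrier_stubShape_of_kleimanSmoothing
    (hKL : Literature.AlgebraicGeometry.HodgeTheory.kleiman1969_smoothingCycles_eightfold_codimFour)
    (hd : 0 < d) (hE : E₀.dim = 1) (hψ : ψ₀ ≫ ψ₀ = -(d • 𝟙 E₀))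
    (Ψ : (((E₀.prod E₀).prod (E₀.prod E₀)).prod (E₀.prod E₀)).prod (E₀.prod E₀) ⟶
      (((E₀.prod E₀).prod (E₀.prod E₀)).prod (E₀.prod E₀)).prod (E₀.prod E₀))
    (hΨ : Ψ = AbelianVariety.prodLift
        (AbelianVariety.fst (((E₀.prod E₀).prod (E₀.prod E₀)).prod (E₀.prod E₀)) (E₀.prod E₀) ≫
          AbelianVariety.prodLift
            (AbelianVariety.fst ((E₀.prod E₀).prod (E₀.prod E₀)) (E₀.prod E₀) ≫
              AbelianVariety.prodLift
                (AbelianVariety.fst (E₀.prod E₀) (E₀.prod E₀) ≫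
                  AbelianVariety.prodLift (AbelianVariety.fst E₀ E₀ ≫ ψ₀) (AbelianVariety.snd E₀ E₀ ≫ (-ψ₀)))
                (AbelianVariety.snd (E₀.prod E₀) (E₀.prod E₀) ≫
                  AbelianVariety.prodLift (AbelianVariety.fst E₀ E₀ ≫ ψ₀) (AbelianVariety.snd E₀ E₀ ≫ (-ψ₀))))
            (AbelianVariety.snd ((E₀.prod E₀).prod (E₀.prod E₀)) (E₀.prod E₀) ≫
              AbelianVariety.prodLift (AbelianVariety.fst E₀ E₀ ≫ ψ₀) (AbelianVariety.snd E₀ E₀ ≫ (-ψ₀))))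
        (AbelianVariety.snd (((E₀.prod E₀).prod (E₀.prod E₀)).prod (E₀.prod E₀)) (E₀.prod E₀) ≫
          AbelianVariety.prodLift (AbelianVariety.fst E₀ E₀ ≫ ψ₀) (AbelianVariety.snd E₀ E₀ ≫ (-ψ₀)))) :
    ∃ (e : ProjectiveEmbedding ((((E₀.prod E₀).prod (E₀.prod E₀)).prod (E₀.prod E₀)).prod (E₀.prod E₀)).X)
      (a : complexBetti (projectiveSpace e.n ℂ) 2)
      (w : complexBetti ((((E₀.prod E₀).prod (E₀.prod E₀)).prod (E₀.prod E₀)).prod (E₀.prod E₀)).X (2 * 4)),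
      IsRationalClass a ∧ a ≠ 0 ∧
      w ∈ weilClassesOf _ Ψ 4 d ∧ IsRationalClass w ∧ w ≠ 0 ∧
      ∃ (Z : Scheme.{0}) (i : Z ⟶ ((((E₀.prod E₀).prod (E₀.prod E₀)).prod (E₀.prod E₀)).prod (E₀.prod E₀)).X.left) (q : ℚ),
        IsClosedImmersion i ∧ IsRegularImmersionOfCodim i 4 ∧ AlgebraicGeometry.IsIntegral Z ∧
        (∀ z ∈ Set.range i.base, (4 : ℕ∞) ≤ Order.coheight z) ∧
        ((q : ℚ) : ℂ) •
            cupPowTwo ((d : ℂ) • complexBetti.map e.ι 2 a + complexBetti.map Ψ.hom.hom.hom 2 (complexBetti.map e.ι 2 a)) 4 + w ∈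
          classesSupportedOn _ (Set.range i.base) (2 * 4) := by
  obtain ⟨hdim, hsq, ⟨e, a, ha, ha0, -⟩, ⟨c, hcQ, hc44, hcW, hc0⟩⟩ := pad4Anchor_hyperbolic_weilClass hE hd hψ Ψ hΨ
  obtain ⟨w', hw'W, hw'r, hw'0, hcar⟩ := exists_lciCarrier_ksymm_of_kleimanSmoothing hKL hd hdim hsq e ha ha0 hcW hcQ hc0
    (pad4Anchor_hodgeClass_mem_algebraicClasses hE hcQ hc44)
  exact ⟨e, a, w', ha, ha0, hw'W, hw'r, hw'0, hcar⟩

/-- **The RUNG `stub_rung_pad4_seedAt` with ONLY its Bloch-semiregularity clause removed, every `d ≥ 1`, modulo Kleiman's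
smoothing**: the same data `(e, a, w)` as in `exists_pad4_carrier_stubShape_of_kleimanSmoothing` can be taken with `(S⁴, Ψ)`
HYPERBOLIC in half-dimension `4` for `h_K = d·e^*a + Ψ^*e^*a` (the anchor's hyperbolic `(e, a)` of `pad4Anchor_hyperbolic_weilClass` is
kept; Kleiman's fact is applied along the auxiliary `K`-symmetric embedding only), together with an integral lci fourfold supporting
`q·h_K⁴ + w`. So, granted the named fact, the rung's ENTIRE remaining content is the Bloch semiregularity
(`IsBlochSemiregular i (2·4) 4`) of SOME such carrier — which smoothing theorems do not give (and which, by the uniform-divisor-ring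
no-go, no `d`-uniform explicit carrier can address). [cite: Bloch1972Semiregularity, Thm. (7.4) and Remark (7.5)]
[cite: Kleiman1969Grassmannians, §5] [cite: vanGeemen1994HodgeAV, Lemma 5.2, 5.3–5.4] -/
theorem exists_pad4_rungMinusSemiregularity_of_kleimanSmoothing
    (hKL : Literature.AlgebraicGeometry.HodgeTheory.kleiman1969_smoothingCycles_eightfold_codimFour)
    (hd : 0 < d) (hE : E₀.dim = 1) (hψ : ψ₀ ≫ ψ₀ = -(d • 𝟙 E₀))
    (Ψ : (((E₀.prod E₀).prod (E₀.prod E₀)).prod (E₀.prod E₀)).prod (E₀.prod E₀) ⟶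
      (((E₀.prod E₀).prod (E₀.prod E₀)).prod (E₀.prod E₀)).prod (E₀.prod E₀))
    (hΨ : Ψ = AbelianVariety.prodLift
        (AbelianVariety.fst (((E₀.prod E₀).prod (E₀.prod E₀)).prod (E₀.prod E₀)) (E₀.prod E₀) ≫
          AbelianVariety.prodLift
            (AbelianVariety.fst ((E₀.prod E₀).prod (E₀.prod E₀)) (E₀.prod E₀) ≫
              AbelianVariety.prodLift
                (AbelianVariety.fst (E₀.prod E₀) (E₀.prod E₀) ≫
                  AbelianVariety.prodLift (AbelianVariety.fst E₀ E₀ ≫ ψ₀) (AbelianVariety.snd E₀ E₀ ≫ (-ψ₀)))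
                (AbelianVariety.snd (E₀.prod E₀) (E₀.prod E₀) ≫
                  AbelianVariety.prodLift (AbelianVariety.fst E₀ E₀ ≫ ψ₀) (AbelianVariety.snd E₀ E₀ ≫ (-ψ₀))))
            (AbelianVariety.snd ((E₀.prod E₀).prod (E₀.prod E₀)) (E₀.prod E₀) ≫
              AbelianVariety.prodLift (AbelianVariety.fst E₀ E₀ ≫ ψ₀) (AbelianVariety.snd E₀ E₀ ≫ (-ψ₀))))
        (AbelianVariety.snd (((E₀.prod E₀).prod (E₀.prod E₀)).prod (E₀.prod E₀)) (E₀.prod E₀) ≫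
          AbelianVariety.prodLift (AbelianVariety.fst E₀ E₀ ≫ ψ₀) (AbelianVariety.snd E₀ E₀ ≫ (-ψ₀)))) :
    ∃ (e : ProjectiveEmbedding ((((E₀.prod E₀).prod (E₀.prod E₀)).prod (E₀.prod E₀)).prod (E₀.prod E₀)).X)
      (a : complexBetti (projectiveSpace e.n ℂ) 2)
      (w : complexBetti ((((E₀.prod E₀).prod (E₀.prod E₀)).prod (E₀.prod E₀)).prod (E₀.prod E₀)).X (2 * 4)),
      IsRationalClass a ∧ a ≠ 0 ∧
      IsHyperbolicWeilType _ Ψ 4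
        ((d : ℂ) • complexBetti.map e.ι 2 a + complexBetti.map Ψ.hom.hom.hom 2 (complexBetti.map e.ι 2 a)) ∧
      w ∈ weilClassesOf _ Ψ 4 d ∧ IsRationalClass w ∧ w ≠ 0 ∧
      ∃ (Z : Scheme.{0}) (i : Z ⟶ ((((E₀.prod E₀).prod (E₀.prod E₀)).prod (E₀.prod E₀)).prod (E₀.prod E₀)).X.left) (q : ℚ),
        IsClosedImmersion i ∧ IsRegularImmersionOfCodim i 4 ∧ AlgebraicGeometry.IsIntegral Z ∧
        (∀ z ∈ Set.range i.base, (4 : ℕ∞) ≤ Order.coheight z) ∧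
        ((q : ℚ) : ℂ) •
            cupPowTwo ((d : ℂ) • complexBetti.map e.ι 2 a + complexBetti.map Ψ.hom.hom.hom 2 (complexBetti.map e.ι 2 a)) 4 + w ∈
          classesSupportedOn _ (Set.range i.base) (2 * 4) := by
  obtain ⟨hdim, hsq, ⟨e, a, ha, ha0, hhyp⟩, ⟨c, hcQ, hc44, hcW, hc0⟩⟩ := pad4Anchor_hyperbolic_weilClass hE hd hψ Ψ hΨ
  obtain ⟨w', hw'W, hw'r, hw'0, hcar⟩ := exists_lciCarrier_ksymm_of_kleimanSmoothing hKL hd hdim hsq e ha ha0 hcW hcQ hc0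
    (pad4Anchor_hodgeClass_mem_algebraicClasses hE hcQ hc44)
  exact ⟨e, a, w', ha, ha0, hhyp, hw'W, hw'r, hw'0, hcar⟩

end Pad4

end Summit.HodgeConjecture.HodgeConjecture.Theorems

end
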